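import Summits.KontsevichZagierPeriods.Zeta5Search.LaiSweepShard

/-!
# `κ₃` sweep certificate — shard file 105 of 127 (shards 735–741 of 889)

HONEST FRAMING. Systematic search; no irrationality claim unless certified. This file only checks,
by `decide +kernel`, shards 735–741 of the order-cell sweep of the `κ₃` point `(74, 2180, 444; δ74)`
(engine `LaiSweepEngine`, soundness `LaiSweepJump/Free/Eval/Shard/Kappa3`; a shard is `⟨regime, n,
p, q, p', q', Lo, Up⟩`: `n` cells from `p/q` to `p'/q'` with integer rate sums in `[Lo, Up]`, `K =
128`, `D = 2^40`). It draws NO conclusion: only the capstone `LaiKappa3SweepCert`, which needs all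
127 shard files, does. Kernel cost of this file ≈ 560 cells × 0.3 s.
-/

namespace Summit.KontsevichZagierPeriods.Zeta5Search.Sweep

set_option maxHeartbeats 100000000 in
/-- Shard 735: 80 cells of regime B from `167/207` to `181/224`.
[cite: Lai2024BallRivoal, §4 Lemma 4.3] -/
theorem shard735 :
    Shard.check 128 (2^40)
      ⟨true, 80, 167, 207, 181, 224, 11216740481069, 17545338026710⟩ = true := by
  decide +kernel

set_option maxHeartbeats 100000000 in
/-- Shard 736: 80 cells of regime B from `181/224` to `263/325`.
[cite: Lai2024BallRivoal, §4 Lemma 4.3] -/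
theorem shard736 :
    Shard.check 128 (2^40)
      ⟨true, 80, 181, 224, 263, 325, 10528394508551, 16485576465952⟩ = true := by
  decide +kernel

set_option maxHeartbeats 100000000 in
/-- Shard 737: 80 cells of regime B from `263/325` to `77/95`.
[cite: Lai2024BallRivoal, §4 Lemma 4.3] -/
theorem shard737 :
    Shard.check 128 (2^40)
      ⟨true, 80, 263, 325, 77, 95, 11404293961134, 17875791174040⟩ = true := by
  decide +kernel

set_option maxHeartbeats 100000000 in
/-- Shard 738: 80 cells of regime B from `77/95` to `69/85`.
[cite: Lai2024BallRivoal, §4 Lemma 4.3] -/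
theorem shard738 :
    Shard.check 128 (2^40)
      ⟨true, 80, 77, 95, 69, 85, 10894779026206, 17095150583880⟩ = true := by
  decide +kernel

set_option maxHeartbeats 100000000 in
/-- Shard 739: 80 cells of regime B from `69/85` to `274/337`.
[cite: Lai2024BallRivoal, §4 Lemma 4.3] -/
theorem shard739 :
    Shard.check 128 (2^40)
      ⟨true, 80, 69, 85, 274, 337, 11349918533141, 17828299484036⟩ = true := by
  decide +kernel

set_option maxHeartbeats 100000000 in
/-- Shard 740: 80 cells of regime B from `274/337` to `978/1201`.
[cite: Lai2024BallRivoal, §4 Lemma 4.3] -/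
theorem shard740 :
    Shard.check 128 (2^40)
      ⟨true, 80, 274, 337, 978, 1201, 11107572320382, 17466139570867⟩ = true := by
  decide +kernel

set_option maxHeartbeats 100000000 in
/-- Shard 741: 80 cells of regime B from `978/1201` to `305/374`.
[cite: Lai2024BallRivoal, §4 Lemma 4.3] -/
theorem shard741 :
    Shard.check 128 (2^40)
      ⟨true, 80, 978, 1201, 305, 374, 10412411401896, 16389833507158⟩ = true := by
  decide +kernel

/-- The checked shards of this file, in order. [folklore] -/
def shards105 : List (CheckedShard 128 (2^40)) :=
  [⟨_, shard735⟩, ⟨_, shard736⟩, ⟨_, shard737⟩, ⟨_, shard738⟩, ⟨_, shard739⟩,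
    ⟨_, shard740⟩, ⟨_, shard741⟩]

end Summit.KontsevichZagierPeriods.Zeta5Search.Sweep
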